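import Summits.BirchSwinnertonDyer.BirchSwinnertonDyer.Theorems.GenusKolyvaginAtTwoGenusPrimitiveSupplyAtTwoPosDiscShallowKFourPosSelmerCountCurrency
import Summits.BirchSwinnertonDyer.BirchSwinnertonDyer.Theorems.GenusKolyvaginAtTwoKFourOfShaRatCard
import Summits.BirchSwinnertonDyer.BirchSwinnertonDyer.Theorems.GenusKolyvaginAtTwoShaConsistencyLawFreeCurrency
import HarnessLib

/-!
# Route `GenusKolyvaginAtTwo`, crux K₄⁺ `K4Pos` (stmt-BirchSwinnertonDyer-31469) — THE SELMER-COUNT CURRENCY OF K₄⁺, EXACT FORM: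
# on the Δ>0 cut with `#Sel₂(E) = 4`, modulo Q2 and GZK, «K4Pos's conclusion» ⟺ `#Sel_(2^M₀)(E/ℚ) = 4^(M₀)`;
# the ℚ-side one-block structure `Ш(E/ℚ)[2^∞] ≃ (ℤ/2^e)²`, `1 ≤ e ≤ M₀`, from Selmer counts

Width seat `bsd-line-gk2-p5` g37 (cell `bsd-f1-sign2`), `--supports stmt-BirchSwinnertonDyer-31469 --as helper`; sequel of
`…KFourPosSelmerCountCurrency` (§1 `#Sel_(2^m)(E/ℚ) = #Ш(E/ℚ)[2^m]`, §2 `#Ш(E/ℚ)[2^∞] = #Sel_(2^M₀)(E/ℚ)` and ★ K4Pos ⟺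
`#Sel_(2^M₀)(E/ℚ) ≠ #Sel_(2^(M₀−1))(E/ℚ)`).  THEOREMS ONLY (no definition, no named fact, no `sorry`); standard axioms.
**BSD is NOT proved by this file; K4Pos is NOT proved; nothing is closed.**

* `natCard_eq_pow_four_of_addEquiv_zmod_sq_of_exponent` — a group `G ≃ (ℤ/2^e)²` with exponent exactly `2^(M₀)` has `e = M₀`, `#G = 4^(M₀)`.
* `exists_addEquiv_shaPrimary_rat_zmod_sq_of_frame` — **THE ℚ-SIDE ONE-BLOCK STRUCTURE FROM SELMER COUNTS**: on K4Pos's cut frame with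
  `#Sel₂(E/ℚ) = 4`, mod Q2 + GZK, `Ш(E/ℚ)[2^∞] ≃ (ℤ/2^e)²` with `1 ≤ e ≤ M₀` and `#Ш(E/ℚ)[2^∞] = #Sel_(2^M₀)(E/ℚ) = 4^e` — from finiteness +
  `#Ш(E/ℚ)[2^∞] = #Sel_(2^M₀)(E/ℚ)` (prequel §2), `#Ш(E/ℚ)[2] = #Sel₂(E/ℚ) = 4` (prequel §1 at `m = 1`), Cassels–Tate hyperbolicity
  `Ш(E/ℚ)[2^∞] ≃ L × L` (tree `CasselsTateNumberField.exists_addEquiv_prod_self_primaryComponent_sha`, unconditional) and LEAD gk2-p1's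
  `KFourCell.exists_addEquiv_zmod_prod_zmod_of_natCard_torsionBy_two_eq_four`; `e ≤ M₀` is B₂, `1 ≤ e` is `#Ш[2] = 4`.  No twin, no sign of `Δ`,
  no `K`-side input (compare gk2-p4 g29's `ShaCores.exists_addEquiv_shaPrimary_prod_of_kramerClass_mem_of_frame`, which reads the same structure off
  the pair-sandwich frame with a capitulating class).
* ★★ `kFourPos_shape_iff_natCard_selmerGroup_eq_pow` — **K4Pos's conclusion ⟺ `#Sel_(2^M₀)(E/ℚ) = 4^(M₀)`** (⟸: prequel §2 + gk2-p4 g29's ★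
  `ShaCores.kFourPos_shape_of_natCard_shaPrimary_rat_eq_pow`; ⟹: prequel ★ gives a class of order `2^(M₀)`, so `e = M₀`).
READING (LEAD-BRIEF-g23-ADDENDUM B.3 in descent currency): the per-curve content of K₄⁺ at depth `M₀` is the single number `#Sel_(2^M₀)(E/ℚ)`
(BSD predicts `4^(M₀)`; depth two: `#Sel₄(E/ℚ) = 16`); class-wide = the `2`-part of BSD in rank `0` given the Gross–Zagier index — OPEN.
BSD is NOT proved by any of this.

References: [SilvermanAEC2009] Thm. X.4.2, X.4.14; [Kolyvagin1989Izv] Thm. B₂; [McCallumLMS1991] §5 Thm. 5.4, Cor. 5.6; [Cassels1962ArithmeticIV] §1;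
[Wall1963QuadraticFormsFiniteGroups] Lemma 7.
-/

set_option autoImplicit false
-- the Theorems namespace of this sub repeats the summit name by design (D-0017 nested layout)
set_option linter.dupNamespace false

noncomputable section

open scoped Classical
open scoped AddSubgroup

namespace Summit.BirchSwinnertonDyer.BirchSwinnertonDyer.Theorems.GenusExact.PlusDescent

open WeierstrassCurve NumberField IsDedekindDomain Field Literature.NumberTheory.EllipticCurves
  Literature.NumberTheory.GaloisRepresentations Literature.NumberTheory.EllipticCurves.ModularForms AddSubgroup
  Literature.NumberTheory.EllipticCurves.RingClassField
open Summit.BirchSwinnertonDyer.BirchSwinnertonDyer.Theses.GenusKolyvaginAtTwo (KolyvaginRelationAtTwo MultPublishedInputsAtTwo)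
open Summit.BirchSwinnertonDyer.BirchSwinnertonDyer.Theorems.GenusSupplyNarrow
  (KFourCell.exists_addEquiv_zmod_prod_zmod_of_natCard_torsionBy_two_eq_four)
open Summit.BirchSwinnertonDyer.BirchSwinnertonDyer.Theorems.GenusExact.ShaCores
  (kFourPos_shape_of_natCard_shaPrimary_rat_eq_pow forall_nsmul_zmod_prod_eq_zero_iff)

/-! ## ★★ K4Pos ⟺ `#Sel_(2^M₀)(E/ℚ) = 4^(M₀)`; the ℚ-side one-block structure from Selmer counts -/

section Exact

/-- **A hyperbolic finite abelian `2`-group `G ≃ (ℤ/2^e)²` whose exponent is exactly `2^(M₀)` (`2^(M₀) · G = 0`, some `g` with `2^(M₀−1) · g ≠ 0`,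
`M₀ ≥ 1`) has `e = M₀` and `#G = 4^(M₀)`.** [cite: Wall1963QuadraticFormsFiniteGroups, Lemma 7] [folklore] -/
theorem natCard_eq_pow_four_of_addEquiv_zmod_sq_of_exponent {G : Type*} [AddCommGroup G] {e M₀ : ℕ} (hM₀ : 1 ≤ M₀)
    (eG : G ≃+ ZMod (2 ^ e) × ZMod (2 ^ e)) (hG : Nat.card G = 4 ^ e)
    (hexp : ∀ g : G, 2 ^ M₀ • g = 0) {g : G} (hg : 2 ^ (M₀ - 1) • g ≠ 0) :
    e = M₀ ∧ Nat.card G = 4 ^ M₀ := by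
  -- `e ≤ M₀`: `2^(M₀)` kills `(ℤ/2^e)²`
  have hle : e ≤ M₀ := by
    rw [← forall_nsmul_zmod_prod_eq_zero_iff e M₀]
    intro x
    have h := hexp (eG.symm x)
    rw [← map_nsmul, eG.symm.map_eq_zero_iff] at h
    exact h
  -- `M₀ ≤ e`: otherwise `2^(M₀−1)` kills `(ℤ/2^e)²`, hence `g`
  have hge : M₀ ≤ e := by
    by_contra hlt
    have hle' : e ≤ M₀ - 1 := by omega
    have hkill := (forall_nsmul_zmod_prod_eq_zero_iff e (M₀ - 1)).mpr hle' (eG g)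
    rw [← map_nsmul, eG.map_eq_zero_iff] at hkill
    exact hg hkill
  have heq : e = M₀ := le_antisymm hle hge
  exact ⟨heq, by rw [hG, heq]⟩

/-- **THE ℚ-SIDE ONE-BLOCK STRUCTURE FROM SELMER COUNTS**: on K4Pos's cut frame with `#Sel₂(E/ℚ) = 4`, modulo Q2 and GZK,
`Ш(E/ℚ)[2^∞] ≃ ℤ/2^e × ℤ/2^e` for some `e` with `1 ≤ e ≤ M₀`, `#Ш(E/ℚ)[2^∞] = 4^e`, and `#Sel_(2^M₀)(E/ℚ) = 4^e`.  Ingredients: finiteness and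
`#Ш(E/ℚ)[2^∞] = #Sel_(2^M₀)(E/ℚ)` (§2), `#Ш(E/ℚ)[2] = #Sel₂(E/ℚ) = 4` (§1, `m = 1`), Cassels–Tate hyperbolicity `Ш(E/ℚ)[2^∞] ≃ L × L` (tree
`CasselsTateNumberField.exists_addEquiv_prod_self_primaryComponent_sha`, unconditional) and `KFourCell.exists_addEquiv_zmod_prod_zmod_of_natCard_torsionBy_two_eq_four`;
`e ≤ M₀` is B₂, `1 ≤ e` is `#Ш[2] = 4`.  The twin and the sign of `Δ` are NOT used.  K4Pos ⟺ `e = M₀` (★★ below).  BSD is NOT proved by this.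
[cite: Cassels1962ArithmeticIV, §1] [cite: Wall1963QuadraticFormsFiniteGroups, Lemma 7] [cite: Kolyvagin1989Izv, Thm. B₂] [cite: SilvermanAEC2009, Thm. X.4.2, X.4.14] -/
theorem exists_addEquiv_shaPrimary_rat_zmod_sq_of_frame (hQ2 : KolyvaginRelationAtTwo) (hGZK : MultPublishedInputsAtTwo)
    (W : WeierstrassCurve ℚ) [W.IsElliptic] [W.IsGloballyMinimal] [NeZero (W.conductorNorm ℤ)] (hcm : ¬ W.HasCM) (hr0 : W.analyticRank = 0)
    (hρ : ∀ n : ℕ, 0 < n → W.HasSurjectiveModNGaloisRep ((2 : ℤ) ^ n)) (hT : Odd W.tamagawaProduct)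
    (hSel4 : Nat.card (W.selmerGroup 2) = 4)
    (v : HeightOneSpectrum (𝓞 ℚ)) (h2v : ((2 : ℕ) : 𝓞 ℚ) ∉ v.asIdeal) (hNv : ((W.conductorNorm ℤ : ℕ) : 𝓞 ℚ) ∈ v.asIdeal)
    (hmult : W.HasMultiplicativeReductionAt v)
    (K : Type) [Field K] [NumberField K] (hIQ : IsImaginaryQuadratic K) (hodd : Odd (NumberField.discr K))
    (h3 : NumberField.discr K ≠ -3) (hHe : SatisfiesHeegnerHypothesis (W.conductorNorm ℤ) K)
    (hsq1 : ¬ IsSquare ((NumberField.discr K : ℚ) * -|W.Δ|)) (hsq2 : ¬ IsSquare ((NumberField.discr K : ℚ) * (-(2 * |W.Δ|))))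
    (Dt : ModularParametrizationData W (W.conductorNorm ℤ)) (β : ℤ) (ι : K →+* ℂ) (d₁ : KolyvaginHeegnerData Dt β ι 1) (M₀ : ℕ)
    (hndiv : ¬ ∃ Q : (W.baseChange (ringClassField K ι 1)).toAffine.Point, ((2 ^ (M₀ + 1) : ℕ) : ℤ) • Q = d₁.derivedPoint) :
    ∃ e : ℕ, Nonempty (AddCommGroup.primaryComponent (↥W.sha) 2 ≃+ ZMod (2 ^ e) × ZMod (2 ^ e)) ∧ 1 ≤ e ∧ e ≤ M₀ ∧
      Nat.card (AddCommGroup.primaryComponent (↥W.sha) 2) = 4 ^ e ∧ Nat.card (W.selmerGroup ((2 ^ M₀ : ℕ) : ℤ)) = 4 ^ e := by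
  haveI : Fact (Nat.Prime 2) := ⟨Nat.prime_two⟩
  have hs2 : W.HasSurjectiveModNGaloisRep 2 := by simpa using hρ 1 one_pos
  have hw : W.rootNumber = 1 :=
    (Literature.Barriers.BirchSwinnertonDyer.even_analyticRank_iff_of_isNewformOf_conductorLevel Dt.isNewformOf).mp
      (by rw [hr0]; exact Even.zero)
  have hrk0 : W.mordellWeilRank = 0 := by rw [(hGZK W (by rw [hr0]; exact zero_le_one)).1, hr0]
  -- `E(ℚ)[2] = 0` (`convert` bridges the decidable-equality instance on `E(ℚ)` used by the general-`F` lemmas of §1)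
  have h2t := forall_eq_zero_of_two_zsmul_eq_zero_of_natCard_torsionBy_two_eq_one W
    (by convert natCard_torsionBy_point_two_eq_one_of_hasSurjectiveModNGaloisRep_two W hs2)
  obtain ⟨hfin, hcard⟩ := natCard_shaPrimary_rat_eq_natCard_selmerGroup_two_pow hQ2 hGZK W hcm hr0 hρ hT v h2v hNv hmult K hIQ hodd h3 hHe hsq1
    hsq2 Dt β ι d₁ M₀ hndiv (le_refl M₀)
  haveI := hfin
  -- `#Ш(E/ℚ)[2] = #Sel₂(E/ℚ) = 4`, transported to the `2`-primary component
  have hSha2 : Nat.card (AddSubgroup.torsionBy (↥W.sha) ((2 : ℕ) : ℤ)) = 4 := by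
    have h := natCard_selmerGroup_two_pow_eq_natCard_shaTorsionBy W hrk0 h2t 1
    rw [pow_one] at h
    rw [← h]
    exact hSel4
  have hSha2' : Nat.card (AddSubgroup.torsionBy (AddCommGroup.primaryComponent (↥W.sha) 2) ((2 : ℕ) : ℤ)) = 4 := by
    have h := GenusExact.CasselsTateNumberField.natCard_sha_torsionBy_pow_eq_primaryComponent W 2 1
    rw [pow_one] at h
    rw [← h]
    exact hSha2
  -- hyperbolicity (Cassels–Tate over `ℚ`, unconditional) and the one-block structure
  obtain ⟨L, ⟨eL⟩⟩ := GenusExact.CasselsTateNumberField.exists_addEquiv_prod_self_primaryComponent_sha W 2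
  have hG : ∀ g : AddCommGroup.primaryComponent (↥W.sha) 2, ∃ k : ℕ, 2 ^ k • g = 0 := fun g ↦ by
    obtain ⟨k, hk⟩ := (AddCommGroup.mem_primaryComponent).mp g.2
    exact ⟨k, Subtype.ext (by rw [AddSubgroupClass.coe_nsmul, ZeroMemClass.coe_zero]; exact hk)⟩
  obtain ⟨e, ⟨eG⟩, hGe⟩ := KFourCell.exists_addEquiv_zmod_prod_zmod_of_natCard_torsionBy_two_eq_four hG eL hSha2'
  -- `e ≤ M₀` (B₂) and `1 ≤ e` (`#Ш[2] = 4 ≠ 1`)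
  have hexp : ∀ g : AddCommGroup.primaryComponent (↥W.sha) 2, 2 ^ M₀ • g = 0 := by
    intro g
    obtain ⟨k, hk⟩ := (AddCommGroup.mem_primaryComponent).mp g.2
    have hka : ((2 ^ k : ℕ) : ℤ) • ((g : ↥W.sha) : W.galH1) = 0 := by
      rw [natCast_zsmul, ← AddSubgroupClass.coe_nsmul, hk, ZeroMemClass.coe_zero]
    have h := two_pow_M0_smul_eq_zero_of_mem_sha_rat_signFree hQ2 W hcm hT v h2v hNv hmult K hIQ hodd h3 hHe hsq1 hsq2 hρ Dt β ι d₁ M₀ hndiv hw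
      k _ (g : ↥W.sha).2 hka
    apply Subtype.ext; apply Subtype.ext
    rw [AddSubgroupClass.coe_nsmul, AddSubgroupClass.coe_nsmul, ← natCast_zsmul, h]; rfl
  have hle : e ≤ M₀ := by
    rw [← forall_nsmul_zmod_prod_eq_zero_iff e M₀]
    intro x
    have h := hexp (eG.symm x)
    rw [← map_nsmul, eG.symm.map_eq_zero_iff] at h
    exact h
  have h1e : 1 ≤ e := by
    by_contra h0
    have he0 : e = 0 := by omega
    rw [he0, pow_zero] at hGe
    -- `#G = 1` contradicts `#G[2] = 4`
    have hle4 : Nat.card (AddSubgroup.torsionBy (AddCommGroup.primaryComponent (↥W.sha) 2) ((2 : ℕ) : ℤ)) ≤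
        Nat.card (AddCommGroup.primaryComponent (↥W.sha) 2) := AddSubgroup.card_le_card_addGroup _
    rw [hSha2', hGe] at hle4
    omega
  exact ⟨e, ⟨eG⟩, h1e, hle, hGe, by rw [← hcard, hGe]⟩

/-- ★★ **K4Pos's CONCLUSION ⟺ `#Sel_(2^M₀)(E/ℚ) = 4^(M₀)`** — on K4Pos's frame restricted to the cut (as in ★, with K4Pos's own cell hypothesis
`#Sel₂(E/ℚ) = 4`), modulo Q2 and GZK.  (⟸) `#Sel_(2^M₀)(E/ℚ) = #Ш(E/ℚ)[2^∞]` (§2), so `#Ш(E/ℚ)[2^∞] = 4^(M₀)` and gk2-p4 g29's ★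
`ShaCores.kFourPos_shape_of_natCard_shaPrimary_rat_eq_pow` gives the witness; (⟹) ★ gives a class of order `2^(M₀)` in `Ш(E/ℚ)[2^∞] ≃ (ℤ/2^e)²`
(`exists_addEquiv_shaPrimary_rat_zmod_sq_of_frame`), so `e = M₀` and `#Sel_(2^M₀)(E/ℚ) = #Ш(E/ℚ)[2^∞] = 4^(M₀)`.  READING: the per-curve content
of K₄⁺ at depth `M₀` is the single number `#Sel_(2^M₀)(E/ℚ)` (BSD predicts `4^(M₀)`); class-wide = the `2`-part of BSD in rank `0` given the
Gross–Zagier index — OPEN.  BSD is NOT proved by this; neither side is proved here.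
[cite: Kolyvagin1989Izv, Thm. B₂] [cite: McCallumLMS1991, §5 Thm. 5.4, Cor. 5.6] [cite: Cassels1962ArithmeticIV, §1] [cite: SilvermanAEC2009, Thm. X.4.2, X.4.14] -/
theorem kFourPos_shape_iff_natCard_selmerGroup_eq_pow (hQ2 : KolyvaginRelationAtTwo) (hGZK : MultPublishedInputsAtTwo)
    (W : WeierstrassCurve ℚ) [W.IsElliptic] [W.IsGloballyMinimal] [NeZero (W.conductorNorm ℤ)] (hcm : ¬ W.HasCM) (hr0 : W.analyticRank = 0)
    (hρ : ∀ n : ℕ, 0 < n → W.HasSurjectiveModNGaloisRep ((2 : ℤ) ^ n)) (hT : Odd W.tamagawaProduct) (hΔ : 0 < W.Δ)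
    (hSel4 : Nat.card (W.selmerGroup 2) = 4)
    (v : HeightOneSpectrum (𝓞 ℚ)) (h2v : ((2 : ℕ) : 𝓞 ℚ) ∉ v.asIdeal) (hNv : ((W.conductorNorm ℤ : ℕ) : 𝓞 ℚ) ∈ v.asIdeal)
    (hmult : W.HasMultiplicativeReductionAt v)
    (K : Type) [Field K] [NumberField K] (hIQ : IsImaginaryQuadratic K) (hodd : Odd (NumberField.discr K))
    (h3 : NumberField.discr K ≠ -3) (hHe : SatisfiesHeegnerHypothesis (W.conductorNorm ℤ) K)
    (hsq1 : ¬ IsSquare ((NumberField.discr K : ℚ) * -|W.Δ|)) (hsq2 : ¬ IsSquare ((NumberField.discr K : ℚ) * (-(2 * |W.Δ|))))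
    (Dt : ModularParametrizationData W (W.conductorNorm ℤ)) (β : ℤ) (ι : K →+* ℂ) (d₁ : KolyvaginHeegnerData Dt β ι 1)
    (hy : ¬ IsOfFinAddOrder d₁.derivedPoint) (M₀ : ℕ) (hM₀ : 1 ≤ M₀)
    (hdiv : ∃ Q : (W.baseChange (ringClassField K ι 1)).toAffine.Point, ((2 ^ M₀ : ℕ) : ℤ) • Q = d₁.derivedPoint)
    (hndiv : ¬ ∃ Q : (W.baseChange (ringClassField K ι 1)).toAffine.Point, ((2 ^ (M₀ + 1) : ℕ) : ℤ) • Q = d₁.derivedPoint)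
    (Wd : WeierstrassCurve ℚ) [Wd.IsElliptic] [Wd.IsGloballyMinimal]
    (hWd : ∃ C : VariableChange ℚ, C • W.quadraticTwist (NumberField.discr K : ℚ) = Wd)
    (hSel : Nat.card (Wd.selmerGroup 2) = 2) (hTam : padicValNat 2 Wd.tamagawaProduct = 0) :
    (∃ (n : ℕ) (d : KolyvaginHeegnerData Dt β ι n), Squarefree n ∧
      (∀ ℓ ∈ n.primeFactors, Zhang2014.IsKolyvaginPrime (W.conductorNorm ℤ) W K 2 ℓ ∧ 2 ≤ Zhang2014.kolyvaginIndex W 2 ℓ ∧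
        ∃ (v : HeightOneSpectrum (𝓞 ℚ)) (𝔓 : Ideal (absIntegers (𝓞 ℚ) ℚ)) (h : absoluteGaloisGroup ℚ),
          ((ℓ : ℕ) : 𝓞 ℚ) ∈ v.asIdeal ∧ 𝔓 ∈ v.primesAbove ∧ IsArithFrobAt (𝓞 ℚ) h 𝔓 ∧ ∃ u : W.geomTorsion ((2 : ℕ) : ℤ), h • u ≠ u) ∧
      ¬ ∃ Q : (W.baseChange (ringClassField K ι n)).toAffine.Point, (2 : ℤ) • Q = d.derivedPoint) ↔
    Nat.card (W.selmerGroup ((2 ^ M₀ : ℕ) : ℤ)) = 4 ^ M₀ := by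
  haveI : Fact (Nat.Prime 2) := ⟨Nat.prime_two⟩
  have hs2 : W.HasSurjectiveModNGaloisRep 2 := by simpa using hρ 1 one_pos
  have hw : W.rootNumber = 1 :=
    (Literature.Barriers.BirchSwinnertonDyer.even_analyticRank_iff_of_isNewformOf_conductorLevel Dt.isNewformOf).mp
      (by rw [hr0]; exact Even.zero)
  have hrk0 : W.mordellWeilRank = 0 := by rw [(hGZK W (by rw [hr0]; exact zero_le_one)).1, hr0]
  -- `E(ℚ)[2] = 0` (`convert` bridges the decidable-equality instance on `E(ℚ)` used by the general-`F` lemmas of §1)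
  have h2t := forall_eq_zero_of_two_zsmul_eq_zero_of_natCard_torsionBy_two_eq_one W
    (by convert natCard_torsionBy_point_two_eq_one_of_hasSurjectiveModNGaloisRep_two W hs2)
  obtain ⟨hfin, hcard⟩ := natCard_shaPrimary_rat_eq_natCard_selmerGroup_two_pow hQ2 hGZK W hcm hr0 hρ hT v h2v hNv hmult K hIQ hodd h3 hHe hsq1
    hsq2 Dt β ι d₁ M₀ hndiv (le_refl M₀)
  haveI := hfin
  constructor
  · intro hK4
    -- ★: a class of `Ш(E/ℚ)[2^(M₀)]` of order `2^(M₀)`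
    obtain ⟨a, ha, hka, hne⟩ := (exists_mem_sha_two_pow_smul_ne_zero_iff_natCard_selmerGroup_ne W hrk0 h2t hM₀).mpr
      ((kFourPos_shape_iff_natCard_selmerGroup_ne hQ2 hGZK W hcm hr0 hρ hT hΔ v h2v hNv hmult K hIQ hodd h3 hHe hsq1 hsq2 Dt β ι d₁ hy M₀ hM₀
        hdiv hndiv Wd hWd hSel hTam).mp hK4)
    -- the one-block structure, and `e = M₀`
    obtain ⟨e, ⟨eG⟩, -, -, hGe, hSelE⟩ := exists_addEquiv_shaPrimary_rat_zmod_sq_of_frame hQ2 hGZK W hcm hr0 hρ hT hSel4 v h2v hNv hmult K hIQ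
      hodd h3 hHe hsq1 hsq2 Dt β ι d₁ M₀ hndiv
    have hexp : ∀ g : AddCommGroup.primaryComponent (↥W.sha) 2, 2 ^ M₀ • g = 0 := by
      intro g
      obtain ⟨k, hk⟩ := (AddCommGroup.mem_primaryComponent).mp g.2
      have hka' : ((2 ^ k : ℕ) : ℤ) • ((g : ↥W.sha) : W.galH1) = 0 := by
        rw [natCast_zsmul, ← AddSubgroupClass.coe_nsmul, hk, ZeroMemClass.coe_zero]
      have h := two_pow_M0_smul_eq_zero_of_mem_sha_rat_signFree hQ2 W hcm hT v h2v hNv hmult K hIQ hodd h3 hHe hsq1 hsq2 hρ Dt β ι d₁ M₀ hndiv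
        hw k _ (g : ↥W.sha).2 hka'
      apply Subtype.ext; apply Subtype.ext
      rw [AddSubgroupClass.coe_nsmul, AddSubgroupClass.coe_nsmul, ← natCast_zsmul, h]; rfl
    -- the class `a` as an element of the primary component
    have haP : (⟨a, ha⟩ : ↥W.sha) ∈ AddCommGroup.primaryComponent (↥W.sha) 2 :=
      (AddCommGroup.mem_primaryComponent).mpr ⟨M₀, Subtype.ext (by
        rw [AddSubgroupClass.coe_nsmul, ZeroMemClass.coe_zero, ← natCast_zsmul]; exact hka)⟩
    have hg : 2 ^ (M₀ - 1) • (⟨⟨a, ha⟩, haP⟩ : AddCommGroup.primaryComponent (↥W.sha) 2) ≠ 0 := by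
      intro h0
      apply hne
      have h := congrArg (fun z : AddCommGroup.primaryComponent (↥W.sha) 2 ↦ ((z : ↥W.sha) : W.galH1)) h0
      simp only [AddSubgroupClass.coe_nsmul, ZeroMemClass.coe_zero] at h
      rw [← natCast_zsmul] at h
      exact h
    obtain ⟨-, hcardM₀⟩ := natCard_eq_pow_four_of_addEquiv_zmod_sq_of_exponent hM₀ eG hGe hexp hg
    rw [← hcard, hcardM₀]
  · intro hSelM₀
    have hY : Nat.card (AddCommGroup.primaryComponent (↥W.sha) 2) = 4 ^ M₀ := by rw [hcard, hSelM₀]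
    exact kFourPos_shape_of_natCard_shaPrimary_rat_eq_pow W hQ2 hcm hT v h2v hNv hmult K hIQ hodd h3 hHe hsq1 hsq2 hρ Dt β ι d₁ M₀ hndiv hw hM₀
      (by rw [hSel4]) hY

end Exact

end Summit.BirchSwinnertonDyer.BirchSwinnertonDyer.Theorems.GenusExact.PlusDescent

end
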